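import Summits.PneNP.PneNP.Theorems.MonotoneSuffices.Negative.BlockParity
import Literature.Computability.Complexity.CircuitLowerBoundsProofs

/-!
# The block-parity detector: semantics, exact miss count, and a linear-size `B₂` circuit

The general (non-monotone) test `detect x` = "some block of `x` is parity-inconsistent" (stored parity
XOR recomputed parity, `blockBit`). On the noise it never fires (`detect_enc`); after planting one point
per block it fails to fire iff every planted position was already a `1` of the noise
(`detect_plantAll_eq_false_iff`, via `par_update`: raising a `0`-bit flips the parity), an event of
exactly `2^{-a}` of the sample space (`two_pow_mul_card_allTrue`, counted without subtraction through
`Equiv.funSplitAt` / `Equiv.subtypePiEquivPi`). The test is a `B₂` circuit with at most `3N` gates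
(`exists_detect_circuit`: XOR chains per block, `cktSize_xorFold`, then the OR of the tree's
`cktSize_any`), in the straight-line `CktSize` calculus of `CircuitComposition.lean`.

Part of the negative-side lemma `monotoneSuffices_false_without_productNoise` for the crux
`Summit.PneNP.PneNP.Theses.KarlinRubin.MonotoneSuffices` (stmt-PneNP-18026, route PneNP/KarlinRubin):
the OR-channel (stochastic-order) generalisation of the crux is false — see
`Summits/PneNP/PneNP/Theorems/MonotoneSuffices/Negative/ORChannel.lean` for the statement, the witness
and the discussion. Everything here is proved (no named facts). Refuter seat
refuter-cdisprove-stmt-PneNP-18026-0 (cdisprove, cycle 1), 2026-08-17.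
-/

set_option linter.dupNamespace false -- `Summit.PneNP.PneNP.…`: summit = sub-problem name (D-0017 single-conjunct layout)

namespace Summit.PneNP.PneNP.Theorems.MonotoneSuffices.Negative

open Finset Function

section Detector

variable {a : ℕ} {β : Type*}

/-- XOR-fold of a Boolean vector over a list of positions. [folklore] -/
def xorFold (l : List β) (v : β → Bool) : Bool := l.foldr (fun i acc => xor (v i) acc) false

/-- XOR-fold of the empty list. [folklore] -/
@[simp] theorem xorFold_nil (v : β → Bool) : xorFold [] v = false := rfl

/-- XOR-fold of a cons. [folklore] -/
@[simp] theorem xorFold_cons (i : β) (l : List β) (v : β → Bool) :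
    xorFold (i :: l) v = xor (v i) (xorFold l v) := rfl

/-- The XOR-fold only depends on the listed positions. [folklore] -/
theorem xorFold_congr {l : List β} {v w : β → Bool} (h : ∀ i ∈ l, v i = w i) :
    xorFold l v = xorFold l w := by
  induction l with
  | nil => rfl
  | cons i l ih =>
    rw [xorFold_cons, xorFold_cons, h i (by simp), ih fun i' hi' => h i' (by simp [hi'])]

/-- Raising one `0`-bit to `1` flips the XOR-fold over any duplicate-free list containing it. [folklore] -/
theorem xorFold_update [DecidableEq β] {l : List β} (hl : l.Nodup) (v : β → Bool) (i : β)
    (hi : i ∈ l) (hv : v i = false) : xorFold l (update v i true) = !xorFold l v := by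
  induction l with
  | nil => simp at hi
  | cons i' l ih =>
    rw [List.nodup_cons] at hl
    rw [xorFold_cons, xorFold_cons]
    by_cases h : i' = i
    · subst h
      have hrest : xorFold l (update v i' true) = xorFold l v :=
        xorFold_congr fun k hk => update_of_ne (ne_of_mem_of_not_mem hk hl.1) _ _
      rw [hrest, update_self, hv]
      simp
    · have hil : i ∈ l := by
        rcases List.mem_cons.1 hi with h' | h'
        · exact absurd h'.symm h
        · exact h'
      rw [ih hl.2 hil, update_of_ne h]
      cases v i' <;> simp

/-- `par` is the XOR-fold over the canonical enumeration. [folklore] -/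
theorem par_eq_xorFold [Fintype β] (v : β → Bool) : par v = xorFold (univ : Finset β).toList v := rfl

/-- Raising one `0`-bit of a block flips its parity. [folklore] -/
theorem par_update [Fintype β] [DecidableEq β] (v : β → Bool) (i : β) (hv : v i = false) :
    par (update v i true) = !par v := by
  rw [par_eq_xorFold, par_eq_xorFold]
  exact xorFold_update (Finset.nodup_toList _) v i (Finset.mem_toList.2 (mem_univ i)) hv

/-- The inconsistency bit of block `j`: stored parity XOR recomputed parity. [folklore] -/
noncomputable def blockBit [Fintype β] (x : Coord a β → Bool) (j : Fin a) : Bool :=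
  xor (x (j, none)) (par fun i => x (j, some i))

/-- **The general detector**: some block is parity-inconsistent. [folklore] -/
noncomputable def detect [Fintype β] (x : Coord a β → Bool) : Bool :=
  (univ : Finset (Fin a)).toList.any fun j => blockBit x j

/-- The noise is always consistent: type-I error of `detect` is `0`. [folklore] -/
theorem detect_enc [Fintype β] (u : Fin a → β → Bool) : detect (enc u) = false := by
  rw [detect, List.any_eq_false]
  intro j _
  have h : (fun i => enc u (j, some i)) = u j := funext fun i => rfl
  simp [blockBit]

/-- Full planting in closed form. [folklore] -/
def plantAll [DecidableEq β] (s : Fin a → β) (x : Coord a β → Bool) : Coord a β → Bool :=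
  fun c => x c || decide (c.2 = some (s c.1))

/-- Planting all `a` blocks in closed form. [folklore] -/
theorem plantUpTo_eq_plantAll [DecidableEq β] (s : Fin a → β) (x : Coord a β → Bool) :
    plantUpTo a s x = plantAll s x := by
  funext c
  simp [plantUpTo, plantAll, c.1.2]

/-- On the free bits of block `j`, planting is one cube step up at `s j`. [folklore] -/
theorem plantAll_enc_block [Fintype β] [DecidableEq β] (s : Fin a → β) (u : Fin a → β → Bool)
    (j : Fin a) : (fun i => plantAll s (enc u) (j, some i)) = update (u j) (s j) true := by
  funext i
  by_cases h : i = s j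
  · subst h; simp [plantAll]
  · rw [update_of_ne h]; simp [plantAll, h]

/-- After planting, block `j` is inconsistent iff its planted position was a `0` of the noise. [folklore] -/
theorem blockBit_plantAll [Fintype β] [DecidableEq β] (s : Fin a → β) (u : Fin a → β → Bool)
    (j : Fin a) : blockBit (plantAll s (enc u)) j = !(u j (s j)) := by
  rw [blockBit, plantAll_enc_block]
  have hpar : plantAll s (enc u) (j, none) = par (u j) := by simp [plantAll]
  rw [hpar]
  cases h : u j (s j)
  · rw [par_update _ _ h]; cases par (u j) <;> rfl
  · have : update (u j) (s j) true = u j := by rw [← h]; exact update_eq_self _ _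
    rw [this]; simp

/-- The detector misses the planting iff every planted position was already a `1`. [folklore] -/
theorem detect_plantAll_eq_false_iff [Fintype β] [DecidableEq β] (s : Fin a → β)
    (u : Fin a → β → Bool) : detect (plantAll s (enc u)) = false ↔ ∀ j, u j (s j) = true := by
  rw [detect, List.any_eq_false]
  simp only [Finset.mem_toList, mem_univ, true_implies, blockBit_plantAll]
  constructor
  · intro h j
    have := h j
    cases hu : u j (s j)
    · rw [hu] at this; simp at this
    · rfl
  · intro h j
    rw [h j]; simp

/-! ### Counting the miss event: `2^a · #{(u,s) | ∀ j, u j (s j) = 1} = #Ω` -/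

/-- Vectors with a prescribed `1` at `i`: exactly half of the cube (stated without subtraction). [folklore] -/
theorem two_mul_card_fixed_true [Fintype β] [DecidableEq β] (i : β) :
    2 * Fintype.card {v : β → Bool // v i = true} = 2 ^ Fintype.card β := by
  have e1 : {v : β → Bool // v i = true} ≃ {q : Bool × ({k : β // k ≠ i} → Bool) // q.1 = true} :=
    (Equiv.funSplitAt i Bool).subtypeEquiv fun v => by simp
  have h1 : Fintype.card {v : β → Bool // v i = true} = Fintype.card ({k : β // k ≠ i} → Bool) := by
    rw [Fintype.card_congr e1, Fintype.card_congr
      (Equiv.prodSubtypeFstEquivSubtypeProd (p := fun b : Bool => b = true)), Fintype.card_prod]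
    simp
  have h2 : Fintype.card (β → Bool) = 2 * Fintype.card ({k : β // k ≠ i} → Bool) := by
    rw [Fintype.card_congr (Equiv.funSplitAt i Bool), Fintype.card_prod, Fintype.card_bool]
  rw [h1, ← h2, Fintype.card_fun, Fintype.card_bool]

/-- For a fixed planting `s`, the noise vectors already `1` on all planted positions are a
`2^{-a}` fraction (stated multiplicatively). [folklore] -/
theorem two_pow_mul_card_allTrue_fixed [Fintype β] [DecidableEq β] (s : Fin a → β) :
    2 ^ a * Fintype.card {u : Fin a → β → Bool // ∀ j, u j (s j) = true} =
      Fintype.card (Fin a → β → Bool) := by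
  rw [Fintype.card_congr (Equiv.subtypePiEquivPi (p := fun j (v : β → Bool) => v (s j) = true)),
    Fintype.card_pi, Fintype.card_fun]
  have h2 : (2 : ℕ) ^ a = ∏ _j : Fin a, 2 := by simp
  rw [h2, ← Finset.prod_mul_distrib]
  simp_rw [two_mul_card_fixed_true]
  rw [Finset.prod_const, card_univ, Fintype.card_fin, Fintype.card_fun, Fintype.card_bool]

/-- **The miss event has probability exactly `2^{-a}`**:
`2^a · #{(u, s) | ∀ j, u j (s j) = 1} = #Ω`. [folklore] -/
theorem two_pow_mul_card_allTrue [Fintype β] [DecidableEq β] :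
    2 ^ a * Fintype.card {p : Ω a β // ∀ j, p.1 j (p.2 j) = true} = Fintype.card (Ω a β) := by
  have e1 : {p : Ω a β // ∀ j, p.1 j (p.2 j) = true} ≃
      {p : (Fin a → β) × (Fin a → β → Bool) // ∀ j, p.2 j (p.1 j) = true} :=
    (Equiv.prodComm _ _).subtypeEquiv fun p => Iff.rfl
  have e2 := Equiv.subtypeProdEquivSigmaSubtype
    (fun (s : Fin a → β) (u : Fin a → β → Bool) => ∀ j, u j (s j) = true)
  rw [Fintype.card_congr (e1.trans e2), Fintype.card_sigma, Finset.mul_sum]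
  simp_rw [two_pow_mul_card_allTrue_fixed]
  rw [Finset.sum_const, card_univ, smul_eq_mul, Fintype.card_prod, mul_comm]

end Detector

section DetectorCircuit

open Literature.Computability.Complexity

/-- The binary XOR gate (any fan-in-2 truth table is in `B₂`). [folklore] -/
def xorGate : GateFn := ⟨2, fun w => xor (w 0) (w 1)⟩

/-- The XOR gate has fan-in `2`. [folklore] -/
theorem xorGate_mem_B2 : xorGate ∈ B2 := by
  show (2 : ℕ) ≤ 2
  exact le_rfl

universe u

/-- An XOR-fold over a list of inputs costs `|l| + 1` gates over `B₂`. [folklore] -/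
theorem cktSize_xorFold {ι : Type u} : ∀ l : List ι,
    CktSize B2 (fun (x : ι → Bool) (_ : Unit) => xorFold l x) (l.length + 1)
  | [] => (cktSize_const ι false).congr fun _ _ => rfl
  | i :: l => by
    have ht := cktSize_xorFold l
    have h1 := (CktSize.proj B2 fun _ : Unit => i).pair ht
    have h2 := h1.comp (CktSize.gate (ι := Unit ⊕ Unit) (B := B2) xorGate xorGate_mem_B2
      ![Sum.inl (), Sum.inr ()])
    refine (h2.of_le (by simp)).congr fun x _ => ?_
    simp only [xorGate, Matrix.cons_val_zero, Matrix.cons_val_one, Sum.elim_inl, Sum.elim_inr,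
      xorFold_cons]

variable {a : ℕ} {β : Type} [Fintype β]

/-- The inconsistency bit of one block costs `|β| + 2` gates over `B₂`. [folklore] -/
theorem cktSize_blockBit (j : Fin a) :
    CktSize B2 (fun (x : Coord a β → Bool) (_ : Unit) => blockBit x j) (Fintype.card β + 2) := by
  set l : List (Coord a β) := (univ : Finset β).toList.map fun i => (j, some i) with hl
  have hfold : ∀ x : Coord a β → Bool, xorFold l x = par fun i => x (j, some i) := by
    intro x
    rw [hl, xorFold, List.foldr_map]
    rfl
  have ht := cktSize_xorFold l
  have h1 := (CktSize.proj B2 fun _ : Unit => ((j, none) : Coord a β)).pair ht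
  have h2 := h1.comp (CktSize.gate (ι := Unit ⊕ Unit) (B := B2) xorGate xorGate_mem_B2
    ![Sum.inl (), Sum.inr ()])
  have hlen : l.length = Fintype.card β := by rw [hl, List.length_map, Finset.length_toList, card_univ]
  refine (h2.of_le (by rw [hlen]; omega)).congr fun x _ => ?_
  simp only [xorGate, Matrix.cons_val_zero, Matrix.cons_val_one, Sum.elim_inl, Sum.elim_inr,
    blockBit, hfold]

/-- **The general detector as a `B₂` circuit of size `≤ a(|β|+3) ≤ 3N`.** [folklore] -/
theorem exists_detect_circuit (ha : 0 < a) :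
    ∃ C : Circuit (Coord a β), C.IsOver B2 ∧ C.size ≤ 3 * Fintype.card (Coord a β) ∧
      ∀ x, C.eval x = detect x := by
  classical
  have h1 : CktSize B2 (fun (x : Coord a β → Bool) (j : Fin a) => blockBit x j)
      (∑ _j : Fin a, (Fintype.card β + 2)) := CktSize.pi fun j => cktSize_blockBit j
  have hne : (univ : Finset (Fin a)).toList ≠ [] := by
    intro h
    rw [Finset.toList_eq_nil, Finset.univ_eq_empty_iff] at h
    exact h.elim ⟨0, ha⟩
  have h2 := h1.comp ((cktSize_any (ι := Fin a) (univ : Finset (Fin a)).toList hne).basis_mono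
    (monotoneBasis_subset_deMorgan.trans deMorganBasis_subset_B2))
  obtain ⟨C, hCB, hCs, hCev⟩ := h2.toCircuit
  refine ⟨C, hCB, hCs.trans ?_, fun x => ?_⟩
  · rw [sum_const, card_univ, Fintype.card_fin, smul_eq_mul, Finset.length_toList, card_univ,
      Fintype.card_fin, card_Coord]
    nlinarith
  · rw [hCev]
    rfl

end DetectorCircuit

end Summit.PneNP.PneNP.Theorems.MonotoneSuffices.Negative
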